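import Summits.BirchSwinnertonDyer.BirchSwinnertonDyer.Theorems.ErratumRoadFiveIMCDivClassicalBGuardedAtomFromThm124bTransfer
import Summits.BirchSwinnertonDyer.BirchSwinnertonDyer.Theorems.ErratumRoadFiveIMCDivClassicalBGuardedOpenInput
import Summits.BirchSwinnertonDyer.BirchSwinnertonDyer.Theorems.ErratumRoadFiveIMCDivClassicalBLambdaMatchingFromFacts
import HarnessLib

/-!
# Route `ErratumRoadFive` (K2, `p ≥ 5`), cruxes (T) `Rest3TorsionBranchAtFive` (item 19702) and (NW)
# `Rest3NoWitnessBranchAtFive` (item 19703) BY NAME from ROAD B12 WITH THE GUARD `d_K ≠ −3` — PART 4: the ∀K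
# conclusion `P2OpenInputOnTreeAt W p` of the items is recovered from the GUARDED atom by ONE-SIDED TIGHTNESS on
# the (ram) rows (imc-p1's `openInputOnTreeAt_of_missingLowerBoundAt_of_ram` with control from JSW 3.3.1-mult)

Cell `bsd-stepL` (run/shared/lean/pub/bsd-stepL/), seat `bsd-stepL-bdp` (prover g24, 2026-08-27). `--supports
stmt-BirchSwinnertonDyer-19702 --as helper`. THEOREMS ONLY (no definition, no named fact, no `sorry`). Memo:
HOME/proof/PROOF-BDP.md §57 (57.12) and §60 (60.3, 60.8).

WHY THIS WORKS DESPITE 57.12. The items conclude the ∀K shape `P2OpenInputOnTreeAt W p`, which at `p ≥ 5` includes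
`K = ℚ(√−3)` — not served by ROAD B12 (BCS25 (disc); UB §43), whence the guard `NumberField.discr K ≠ -3` of PARTS 1–3
(p558697 ∕ p561501 ∕ p561251). But both items live on (ram) rows, where the open input is TIGHT: the numerical lower
half `Typed.MissingLowerBoundAt W p` ALONE returns `P2OpenInputOnTreeAt W p` at EVERY field (imc-p1 p422211 +
`p2ControlOnTreeAt_of_thm331Mult` = `openInputOnTreeAt_of_missingLowerBoundAt_of_ram_of_thm331Mult`), and PART 3 §8
gives that lower half from the GUARDED atom through ONE Hoffstein–Luo field (`|d_K| > 4`). Off `ClassX11b ∧ 5 ≤ p`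
the conclusion is vacuous; on it `Surj` follows from `Irr ∧ Ram`. §9 ∕ §10: items 19702 ∕ 19703 BY NAME ⟸ guarded
atom on their rows + JIMJ18 display + JSW 3.3.1-mult + route p2's facts; §11 ∕ §12: the same RESOLVED INTO ROAD
B12's SOURCES {Hsieh 2014 Thm 5.6 + BDP13 Thm 5.5 (FRAME, p512577), BCS25 Thm 1.2.4 (b) + Prop 4.2.2, JIMJ18, JSW
3.3.1-mult, route p2's facts} + the two OPEN memo-proved shapes UB♯|ᵍ, TRANSFER|ᵍ on the rows (PART 2 §4 inside).

HONEST FRAMING: CONDITIONAL theorems — UB♯|ᵍ (PROOF-BDP §55, refereed) and TRANSFER|ᵍ (§40 ∕ §37.11 ∕ §58; a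
partner exists exactly on the finite-flat locus, which CONTAINS all 3 687 (T) pairs, 57.2) are OPEN typed shapes;
the named facts are carried by name (flag D1 on Thm 1.2.4; JSW 3.3.1-mult PUB); nothing is discharged, booked or
re-labelled (T7); the items stay OPEN; BSD is proved for no pair. NOT Theses-free (p512577's cone): a helper.

References: [Castella2018] 2.3 ∕ 3.1 ∕ 3.2 ∕ §5; [Castella2018Erratum] (2.4); [JetchevSkinnerWan2017] 3.3.1; [Hsieh2014]
5.6; [BertoliniDarmonPrasanna2013] 5.5; arXiv:2405.00270v2 1.2.4 (b), 4.2.2; [HoffsteinLuo1997]; PROOF-BDP §57, §60.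
-/

set_option autoImplicit false
set_option linter.dupNamespace false

noncomputable section

open scoped Classical NumberField Topology

open Filter WeierstrassCurve NumberField IsDedekindDomain Field PowerSeries
open Literature.NumberTheory.EllipticCurves Literature.NumberTheory.EllipticCurves.GreenbergSelmer
open Literature.NumberTheory.EllipticCurves.ModularForms
open Literature.NumberTheory.EllipticCurves.Rank1Residual
open Literature.NumberTheory.EllipticCurves.Rank1Residual.Typed
open Literature.NumberTheory.EllipticCurves.Castella2018
open Literature.NumberTheory.EllipticCurves.Castella2018Exceptional
open Literature.NumberTheory.EllipticCurves.Wuthrich2014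
open Literature.NumberTheory.EllipticCurves.JetchevSkinnerWan2017
open Literature.NumberTheory.GaloisRepresentations Literature.NumberTheory.GaloisCohomology
open Literature.NumberTheory.Automorphic
open Summit.BirchSwinnertonDyer.Rank1Residual Summit.BirchSwinnertonDyer.Rank1Residual.X11b
open Summit.BirchSwinnertonDyer.Rank1Residual.X11b.AcSelmer
open Summit.BirchSwinnertonDyer.Rank1Residual.X11b.Halves
open Summit.BirchSwinnertonDyer.BirchSwinnertonDyer.Theorems.Rest3TorsionBranchB

namespace Summit.BirchSwinnertonDyer.BirchSwinnertonDyer.Theorems.Rest3GuardedB12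

/-! ### §9–§10 The items from the GUARDED atom on their rows (tightness on (ram)) -/

/-- **Item 19702 `Rest3TorsionBranchAtFive` BY NAME ⟸ the GUARDED atom (2.4)∃♭ᴮ|ᵍ on its rows + the JIMJ18
display + JSW 3.3.1-mult + route p2's published facts.** Per pair: off `ClassX11b ∧ 5 ≤ p` the conclusion is
vacuous; on it, `Surj` from `Irr ∧ Ram`, PART 3 §8 gives `Typed.MissingLowerBoundAt W p` (one Hoffstein–Luo field,
`|d_K| > 4`), and one-sided tightness on (ram) returns `P2OpenInputOnTreeAt W p` at every field. CONDITIONAL;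
nothing booked. [cite: JetchevSkinnerWan2017, Thm. 3.3.1 with §3.5 (3.5.c) (arXiv:1512.06894 pp. 11, 15)]
[cite: Castella2018Exceptional, Thms. 2.10–2.11 (arXiv:1507.04260 pp. 13–14)]
[cite: Castella2018, Thm. 2.3 (p. 5), Thm. 3.2 (p. 9)] [cite: Skinner2016PacificMC, Thm. C (§1) and footnote 1]
[cite: HoffsteinLuo1997, Theorem] -/
theorem rest3TorsionBranchAtFive_of_imcDivSomeFrameB_guarded_of_pNew_of_thm331Mult
    (h331 : thm331_anticyclotomicControl_mult)
    (hGZ : ∀ (N : ℕ) [NeZero N] (W : WeierstrassCurve ℚ) (K : Type) [Field K] [NumberField K],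
      gross_zagier N W K)
    (hKo : ∀ (N : ℕ) [NeZero N] (W : WeierstrassCurve ℚ) (K : Type) [Field K] [NumberField K],
      kolyvagin N W K)
    (hSk : Skinner2016.thmC_padicValRat_bsd_rank_zero) (hWu : sha_dvd_analyticSha)
    (hGZK : rank_eq_analyticRank_of_analyticRank_le_one) (hmod : hasEntireLFunction_rat)
    (hnf : exists_isNewformOf) (hMaz : mazur_not_dvd_maninConstant_of_odd)
    (hHL : HoffsteinLuo1997_exists_twist_L_one_ne_zero)
    (hPT : ∀ (K : Type) [Field K] [NumberField K], poitouTate_sum_localTatePairing_eq_zero K)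
    (hEP : ∀ (K : Type) [Field K] [NumberField K] (v : HeightOneSpectrum (𝓞 K)),
      localEulerPoincareCharacteristic (v.adicCompletion K))
    (hB : thm210_thm211_bdpDisplay_pNew)
    (hDiv : ∀ (W : WeierstrassCurve ℚ) [W.IsElliptic] [W.IsGloballyMinimal] (p : ℕ) [Fact p.Prime],
      Ram W p → (∃ P : (W.baseChange ℚ_[p]).toAffine.Point, p • P = 0 ∧ P ≠ 0) →
      ∀ (N : ℕ) [NeZero N] (K : Type) [Field K] [NumberField K]
        (Dt : ModularParametrizationData W N) (H : HeegnerDatum N (NumberField.discr K)) (ι : K →+* ℂ)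
        (P : (W.baseChange K).toAffine.Point),
        ClassX11b W p → 5 ≤ p → Surj W p → W.conductorNorm ℤ = N → IsImaginaryQuadratic K →
        Odd (NumberField.discr K) → NumberField.discr K ≠ -3 → ¬ (p : ℤ) ∣ NumberField.discr K →
        ¬ p ∣ Units.torsionOrder K → SatisfiesHeegnerHypothesis N K →
        (W.quadraticTwist (NumberField.discr K : ℚ)).entireLFunction 1 ≠ 0 →
        WeierstrassCurve.Affine.Point.map ι.toRatAlgHom P = heegnerPointComplex Dt H →
        ¬ (p : ℤ) ∣ Dt.c → ¬ IsOfFinAddOrder P →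
        ∀ (κ : ZpExtension K p), κ.IsAnticyclotomic →
          ∀ (γ : Field.absoluteGaloisGroup K) [Fact (κ.IsTopGenerator γ)]
            (ι' : PadicAlgCl p ≃+* ℂ) (w₀ : InfinitePlace K) (P' : (W.baseChange K).toAffine.Point),
            WeierstrassCurve.Affine.Point.map w₀.embedding.toRatAlgHom P' = heegnerPointComplex Dt H →
            ∀ (e : K →+* ℚ_[p]),
              (∀ k : 𝓞 K, k ∈ (primeOfEmbeddingDatum p ι' w₀.embedding).asIdeal ↔ ‖e (k : K)‖ < 1) →
              ∃ (ΩK : ℂ) (Ωp : ℂ_[p]) (Q : PowerSeries 𝓞_ℂ_[p]), ΩK ≠ 0 ∧ ‖Ωp‖ = 1 ∧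
                R1.IsBDPLFunctionInt p ι' (primeOfEmbeddingDatum p ι' w₀.embedding) κ γ Dt.f ΩK Ωp Q ∧
                ∀ (𝔭bar : HeightOneSpectrum (𝓞 K)), ((p : ℕ) : 𝓞 K) ∈ 𝔭bar.asIdeal →
                  𝔭bar ≠ primeOfEmbeddingDatum p ι' w₀.embedding →
                  (XAc.charIdeal (W.baseChange K) p κ 𝔭bar ∅ γ).map (PowerSeries.map (R1.toCpInt p)) ≤
                    Ideal.span {Q}) :
    Rest3TorsionBranchAtFive := by
  intro W _ _ p _ hram hP
  by_cases hX5 : ClassX11b W p ∧ 5 ≤ p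
  · obtain ⟨hX, hp5⟩ := hX5
    have hsurj : Surj W p := surj_of_irr_of_ram W p hX.2.2.2 hram
    exact openInputOnTreeAt_of_missingLowerBoundAt_of_ram_of_thm331Mult W p h331 hGZ hKo hSk hGZK hmod hram
      (missingLowerBoundAt_of_imcDivSomeFrameB_guarded_of_pNew hGZ hKo hWu hGZK hmod hnf hMaz hHL hPT hEP hB
        (hDiv W p hram hP) hX hp5 hsurj)
  · intro N _ K _ _ Dt H ι P hX hp5
    exact absurd ⟨hX, hp5⟩ hX5

/-- **Item 19703 `Rest3NoWitnessBranchAtFive` BY NAME ⟸ the GUARDED atom on its rows + the JIMJ18 display + JSW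
3.3.1-mult + route p2's published facts** (as §9). CONDITIONAL; nothing booked.
[cite: JetchevSkinnerWan2017, Thm. 3.3.1 with §3.5 (3.5.c) (arXiv:1512.06894 pp. 11, 15)]
[cite: Castella2018Exceptional, Thms. 2.10–2.11 (arXiv:1507.04260 pp. 13–14)]
[cite: Castella2018, Thm. 2.3 (p. 5), Thm. 3.2 (p. 9)] [cite: Skinner2016PacificMC, Thm. C (§1) and footnote 1]
[cite: HoffsteinLuo1997, Theorem] -/
theorem rest3NoWitnessBranchAtFive_of_imcDivSomeFrameB_guarded_of_pNew_of_thm331Mult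
    (h331 : thm331_anticyclotomicControl_mult)
    (hGZ : ∀ (N : ℕ) [NeZero N] (W : WeierstrassCurve ℚ) (K : Type) [Field K] [NumberField K],
      gross_zagier N W K)
    (hKo : ∀ (N : ℕ) [NeZero N] (W : WeierstrassCurve ℚ) (K : Type) [Field K] [NumberField K],
      kolyvagin N W K)
    (hSk : Skinner2016.thmC_padicValRat_bsd_rank_zero) (hWu : sha_dvd_analyticSha)
    (hGZK : rank_eq_analyticRank_of_analyticRank_le_one) (hmod : hasEntireLFunction_rat)
    (hnf : exists_isNewformOf) (hMaz : mazur_not_dvd_maninConstant_of_odd)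
    (hHL : HoffsteinLuo1997_exists_twist_L_one_ne_zero)
    (hPT : ∀ (K : Type) [Field K] [NumberField K], poitouTate_sum_localTatePairing_eq_zero K)
    (hEP : ∀ (K : Type) [Field K] [NumberField K] (v : HeightOneSpectrum (𝓞 K)),
      localEulerPoincareCharacteristic (v.adicCompletion K))
    (hB : thm210_thm211_bdpDisplay_pNew)
    (hDiv : ∀ (W : WeierstrassCurve ℚ) [W.IsElliptic] [W.IsGloballyMinimal] (p : ℕ) [Fact p.Prime],
      Ram W p → (∀ P : (W.baseChange ℚ_[p]).toAffine.Point, p • P = 0 → P = 0) →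
      ¬ (∃ (q : ℕ) (_ : Fact q.Prime), q ≠ 2 ∧ q ≠ p ∧ Mult W q ∧
          ¬ W.HasSplitMultiplicativeReductionAtPrime q ∧ ¬ p ∣ padicValInt q W.minimalDiscriminantInt) →
      ∀ (N : ℕ) [NeZero N] (K : Type) [Field K] [NumberField K]
        (Dt : ModularParametrizationData W N) (H : HeegnerDatum N (NumberField.discr K)) (ι : K →+* ℂ)
        (P : (W.baseChange K).toAffine.Point),
        ClassX11b W p → 5 ≤ p → Surj W p → W.conductorNorm ℤ = N → IsImaginaryQuadratic K →
        Odd (NumberField.discr K) → NumberField.discr K ≠ -3 → ¬ (p : ℤ) ∣ NumberField.discr K →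
        ¬ p ∣ Units.torsionOrder K → SatisfiesHeegnerHypothesis N K →
        (W.quadraticTwist (NumberField.discr K : ℚ)).entireLFunction 1 ≠ 0 →
        WeierstrassCurve.Affine.Point.map ι.toRatAlgHom P = heegnerPointComplex Dt H →
        ¬ (p : ℤ) ∣ Dt.c → ¬ IsOfFinAddOrder P →
        ∀ (κ : ZpExtension K p), κ.IsAnticyclotomic →
          ∀ (γ : Field.absoluteGaloisGroup K) [Fact (κ.IsTopGenerator γ)]
            (ι' : PadicAlgCl p ≃+* ℂ) (w₀ : InfinitePlace K) (P' : (W.baseChange K).toAffine.Point),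
            WeierstrassCurve.Affine.Point.map w₀.embedding.toRatAlgHom P' = heegnerPointComplex Dt H →
            ∀ (e : K →+* ℚ_[p]),
              (∀ k : 𝓞 K, k ∈ (primeOfEmbeddingDatum p ι' w₀.embedding).asIdeal ↔ ‖e (k : K)‖ < 1) →
              ∃ (ΩK : ℂ) (Ωp : ℂ_[p]) (Q : PowerSeries 𝓞_ℂ_[p]), ΩK ≠ 0 ∧ ‖Ωp‖ = 1 ∧
                R1.IsBDPLFunctionInt p ι' (primeOfEmbeddingDatum p ι' w₀.embedding) κ γ Dt.f ΩK Ωp Q ∧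
                ∀ (𝔭bar : HeightOneSpectrum (𝓞 K)), ((p : ℕ) : 𝓞 K) ∈ 𝔭bar.asIdeal →
                  𝔭bar ≠ primeOfEmbeddingDatum p ι' w₀.embedding →
                  (XAc.charIdeal (W.baseChange K) p κ 𝔭bar ∅ γ).map (PowerSeries.map (R1.toCpInt p)) ≤
                    Ideal.span {Q}) :
    Rest3NoWitnessBranchAtFive := by
  intro W _ _ p _ hram htors hno
  by_cases hX5 : ClassX11b W p ∧ 5 ≤ p
  · obtain ⟨hX, hp5⟩ := hX5
    have hsurj : Surj W p := surj_of_irr_of_ram W p hX.2.2.2 hram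
    exact openInputOnTreeAt_of_missingLowerBoundAt_of_ram_of_thm331Mult W p h331 hGZ hKo hSk hGZK hmod hram
      (missingLowerBoundAt_of_imcDivSomeFrameB_guarded_of_pNew hGZ hKo hWu hGZK hmod hnf hMaz hHL hPT hEP hB
        (hDiv W p hram htors hno) hX hp5 hsurj)
  · intro N _ K _ _ Dt H ι P hX hp5
    exact absurd ⟨hX, hp5⟩ hX5

/-! ### §11–§12 The items RESOLVED INTO ROAD B12's SOURCES -/

/-- **Item 19702 `Rest3TorsionBranchAtFive` BY NAME ⟸ {Hsieh 2014 Thm 5.6 + BDP13 Thm 5.5 (FRAME), BCS25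
Thm 1.2.4 (b) + Prop 4.2.2, the JIMJ18 display, JSW 3.3.1-mult, route p2's published facts} + UB♯|ᵍ + TRANSFER|ᵍ
on the (T) rows** — ROAD B12 with the guard `d_K ≠ −3`, end to end: FRAME by p512577
(`P2.unrFrame_of_hsieh2014_unrPeriod_of_bdp2013`), the guarded atom display by PART 2
(`P2.imcDivSomeFrameB_guarded_of_thm124b_of_unrFrame_of_upperDivisibility_of_transfer`), then §9. The two OPEN
shapes are memo-proved (UB♯: PROOF-BDP §55, refereed; TRANSFER: §40 ∕ §37.11 ∕ §58, partner on the finite-flat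
locus ⊇ all (T) pairs). CONDITIONAL; nothing booked; the item stays OPEN.
[cite: Hsieh2014, Thm. 5.6 (arXiv:1112.1580 p. 23)] [cite: BertoliniDarmonPrasanna2013, Thm. 5.5 and (5.1.16)]
[cite: BurungaleCastellaSkinner2025, Thm. 1.2.4 (b) and Prop. 4.2.2 (arXiv:2405.00270v2 pp. 3, 8–9)]
[cite: JetchevSkinnerWan2017, Thm. 3.3.1 with §3.5 (3.5.c)] [cite: Castella2018Exceptional, Thms. 2.10–2.11]
[cite: Castella2018, Thms. 2.3, 3.1, 3.2, §5] [cite: HoffsteinLuo1997, Theorem] -/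
theorem rest3TorsionBranchAtFive_of_thm124b_of_upperDivisibility_of_transfer_of_thm331Mult
    (hH : hsieh2014_exists_anticyclotomicPAdicLFunction_unrPeriod)
    (hR : bertoliniDarmonPrasanna2013_centralValue_reciprocity)
    (h124 : BurungaleCastellaSkinner2025.thm124b_exists_isBDPLFunction_isTorsion_charIdeal_eq)
    (h422 : BurungaleCastellaSkinner2025.prop422_exists_isBDPLFunction_mu_eq_zero)
    (h331 : thm331_anticyclotomicControl_mult)
    (hGZ : ∀ (N : ℕ) [NeZero N] (W : WeierstrassCurve ℚ) (K : Type) [Field K] [NumberField K],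
      gross_zagier N W K)
    (hKo : ∀ (N : ℕ) [NeZero N] (W : WeierstrassCurve ℚ) (K : Type) [Field K] [NumberField K],
      kolyvagin N W K)
    (hSk : Skinner2016.thmC_padicValRat_bsd_rank_zero) (hWu : sha_dvd_analyticSha)
    (hGZK : rank_eq_analyticRank_of_analyticRank_le_one) (hmod : hasEntireLFunction_rat)
    (hnf : exists_isNewformOf) (hMaz : mazur_not_dvd_maninConstant_of_odd)
    (hHL : HoffsteinLuo1997_exists_twist_L_one_ne_zero)
    (hPT : ∀ (K : Type) [Field K] [NumberField K], poitouTate_sum_localTatePairing_eq_zero K)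
    (hEP : ∀ (K : Type) [Field K] [NumberField K] (v : HeightOneSpectrum (𝓞 K)),
      localEulerPoincareCharacteristic (v.adicCompletion K))
    (hB : thm210_thm211_bdpDisplay_pNew)
    (hUB : ∀ (W : WeierstrassCurve ℚ) [W.IsElliptic] [W.IsGloballyMinimal] (p : ℕ) [Fact p.Prime],
      Ram W p → (∃ P : (W.baseChange ℚ_[p]).toAffine.Point, p • P = 0 ∧ P ≠ 0) →
      ∀ (N : ℕ) [NeZero N] (K : Type) [Field K] [NumberField K]
        (Dt : ModularParametrizationData W N) (H : HeegnerDatum N (NumberField.discr K)) (ι : K →+* ℂ)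
        (P : (W.baseChange K).toAffine.Point),
        ClassX11b W p → 5 ≤ p → Surj W p → W.conductorNorm ℤ = N → IsImaginaryQuadratic K →
        Odd (NumberField.discr K) → NumberField.discr K ≠ -3 → ¬ (p : ℤ) ∣ NumberField.discr K →
        ¬ p ∣ Units.torsionOrder K → SatisfiesHeegnerHypothesis N K →
        (W.quadraticTwist (NumberField.discr K : ℚ)).entireLFunction 1 ≠ 0 →
        WeierstrassCurve.Affine.Point.map ι.toRatAlgHom P = heegnerPointComplex Dt H →
        ¬ (p : ℤ) ∣ Dt.c → ¬ IsOfFinAddOrder P →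
        ∀ (κ : ZpExtension K p), κ.IsAnticyclotomic →
          ∀ (γ : Field.absoluteGaloisGroup K) [Fact (κ.IsTopGenerator γ)]
            (ι' : PadicAlgCl p ≃+* ℂ) (w₀ : InfinitePlace K) (P' : (W.baseChange K).toAffine.Point),
            WeierstrassCurve.Affine.Point.map w₀.embedding.toRatAlgHom P' = heegnerPointComplex Dt H →
            ∀ (e : K →+* ℚ_[p]),
              (∀ k : 𝓞 K, k ∈ (primeOfEmbeddingDatum p ι' w₀.embedding).asIdeal ↔ ‖e (k : K)‖ < 1) →
              ∀ (ΩK : ℂ) (Ωp : (unrIntegers p)ˣ) (L : UnrSeries p), ΩK ≠ 0 →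
                IsBDPLFunction ι' (primeOfEmbeddingDatum p ι' w₀.embedding) κ γ Dt.f ΩK
                  ((Ωp : unrIntegers p) : ℂ_[p]) L →
                ∀ (𝔭bar : HeightOneSpectrum (𝓞 K)), ((p : ℕ) : 𝓞 K) ∈ 𝔭bar.asIdeal →
                  𝔭bar ≠ primeOfEmbeddingDatum p ι' w₀.embedding →
                  L ∈ (XAc.charIdeal (W.baseChange K) p κ 𝔭bar ∅ γ).map (PowerSeries.map (toUnr p)))
    (hTR : ∀ (W : WeierstrassCurve ℚ) [W.IsElliptic] [W.IsGloballyMinimal] (p : ℕ) [Fact p.Prime],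
      Ram W p → (∃ P : (W.baseChange ℚ_[p]).toAffine.Point, p • P = 0 ∧ P ≠ 0) →
      ∀ (N : ℕ) [NeZero N] (K : Type) [Field K] [NumberField K]
        (Dt : ModularParametrizationData W N) (H : HeegnerDatum N (NumberField.discr K)) (ι : K →+* ℂ)
        (P : (W.baseChange K).toAffine.Point),
        ClassX11b W p → 5 ≤ p → Surj W p → W.conductorNorm ℤ = N → IsImaginaryQuadratic K →
        Odd (NumberField.discr K) → NumberField.discr K ≠ -3 → ¬ (p : ℤ) ∣ NumberField.discr K →
        ¬ p ∣ Units.torsionOrder K → SatisfiesHeegnerHypothesis N K →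
        (W.quadraticTwist (NumberField.discr K : ℚ)).entireLFunction 1 ≠ 0 →
        WeierstrassCurve.Affine.Point.map ι.toRatAlgHom P = heegnerPointComplex Dt H →
        ¬ (p : ℤ) ∣ Dt.c → ¬ IsOfFinAddOrder P →
        ∀ (κ : ZpExtension K p), κ.IsAnticyclotomic →
          ∀ (γ : Field.absoluteGaloisGroup K) [Fact (κ.IsTopGenerator γ)]
            (ι' : PadicAlgCl p ≃+* ℂ) (w₀ : InfinitePlace K) (P' : (W.baseChange K).toAffine.Point),
            WeierstrassCurve.Affine.Point.map w₀.embedding.toRatAlgHom P' = heegnerPointComplex Dt H →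
            ∀ (e : K →+* ℚ_[p]),
              (∀ k : 𝓞 K, k ∈ (primeOfEmbeddingDatum p ι' w₀.embedding).asIdeal ↔ ‖e (k : K)‖ < 1) →
              ∀ (ΩK : ℂ) (Ωp : (unrIntegers p)ˣ) (L : UnrSeries p), ΩK ≠ 0 →
                IsBDPLFunction ι' (primeOfEmbeddingDatum p ι' w₀.embedding) κ γ Dt.f ΩK
                  ((Ωp : unrIntegers p) : ℂ_[p]) L →
                ∀ (𝔭bar : HeightOneSpectrum (𝓞 K)), ((p : ℕ) : 𝓞 K) ∈ 𝔭bar.asIdeal →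
                  𝔭bar ≠ primeOfEmbeddingDatum p ι' w₀.embedding →
                  ∃ (W' : WeierstrassCurve ℚ) (_ : W'.IsElliptic) (_ : W'.IsGloballyMinimal) (N' : ℕ)
                    (_ : NeZero N') (Dt' : ModularParametrizationData W' N'),
                    GoodOrd W' p ∧ Surj W' p ∧ SatisfiesHeegnerHypothesis N' K ∧
                    ∀ (g g' : IwasawaAlgebra p),
                      XAc.charIdeal (W.baseChange K) p κ 𝔭bar ∅ γ = Ideal.span {g} →
                      XAc.charIdeal (W'.baseChange K) p κ 𝔭bar ∅ γ = Ideal.span {g'} →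
                      ∀ (ΩK' : ℂ) (Ωp' : (unrIntegers p)ˣ) (L' : UnrSeries p), ΩK' ≠ 0 →
                        IsBDPLFunction ι' (primeOfEmbeddingDatum p ι' w₀.embedding) κ γ Dt'.f ΩK'
                          ((Ωp' : unrIntegers p) : ℂ_[p]) L' →
                        ∃ (P P' u : UnrSeries p) (m m' : ℕ),
                          (‖((coeff m P : unrIntegers p) : ℂ_[p])‖ = 1 ∧
                            ∀ i < m, ‖((coeff i P : unrIntegers p) : ℂ_[p])‖ < 1) ∧
                          (‖((coeff m' P' : unrIntegers p) : ℂ_[p])‖ = 1 ∧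
                            ∀ i < m', ‖((coeff i P' : unrIntegers p) : ℂ_[p])‖ < 1) ∧
                          IsUnit u ∧
                          (∀ i, ‖((coeff i (u * (L' * P')) : unrIntegers p) : ℂ_[p]) -
                            ((coeff i (L * P) : unrIntegers p) : ℂ_[p])‖ < 1) ∧
                          ((∃ a, (‖((coeff a (PowerSeries.map (toUnr p) g * P) : unrIntegers p) : ℂ_[p])‖ = 1 ∧
                              ∀ i < a, ‖((coeff i (PowerSeries.map (toUnr p) g * P) : unrIntegers p) :
                                ℂ_[p])‖ < 1)) →
                            ∃ a', (‖((coeff a' (PowerSeries.map (toUnr p) g' * P') : unrIntegers p) :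
                              ℂ_[p])‖ = 1 ∧
                              ∀ i < a', ‖((coeff i (PowerSeries.map (toUnr p) g' * P') : unrIntegers p) :
                                ℂ_[p])‖ < 1)) ∧
                          (∀ a a', (‖((coeff a (PowerSeries.map (toUnr p) g * P) : unrIntegers p) : ℂ_[p])‖ = 1 ∧
                              ∀ i < a, ‖((coeff i (PowerSeries.map (toUnr p) g * P) : unrIntegers p) :
                                ℂ_[p])‖ < 1) →
                            (‖((coeff a' (PowerSeries.map (toUnr p) g' * P') : unrIntegers p) : ℂ_[p])‖ = 1 ∧
                              ∀ i < a', ‖((coeff i (PowerSeries.map (toUnr p) g' * P') : unrIntegers p) :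
                                ℂ_[p])‖ < 1) → a = a')) :
    Rest3TorsionBranchAtFive :=
  rest3TorsionBranchAtFive_of_imcDivSomeFrameB_guarded_of_pNew_of_thm331Mult h331 hGZ hKo hSk hWu hGZK hmod hnf
    hMaz hHL hPT hEP hB
    (fun W _ _ p _ hram hP ↦
      P2.imcDivSomeFrameB_guarded_of_thm124b_of_unrFrame_of_upperDivisibility_of_transfer h124 h422
        (P2.unrFrame_of_hsieh2014_unrPeriod_of_bdp2013 hH hR) (hUB W p hram hP) (hTR W p hram hP))

/-- **Item 19703 `Rest3NoWitnessBranchAtFive` BY NAME, resolved into ROAD B12's sources** (as §11, on the (NW)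
rows). CONDITIONAL; nothing booked; the item stays OPEN.
[cite: Hsieh2014, Thm. 5.6 (arXiv:1112.1580 p. 23)] [cite: BertoliniDarmonPrasanna2013, Thm. 5.5 and (5.1.16)]
[cite: BurungaleCastellaSkinner2025, Thm. 1.2.4 (b) and Prop. 4.2.2 (arXiv:2405.00270v2 pp. 3, 8–9)]
[cite: JetchevSkinnerWan2017, Thm. 3.3.1 with §3.5 (3.5.c)] [cite: Castella2018Erratum, (2.4) (p. 4)] -/
theorem rest3NoWitnessBranchAtFive_of_thm124b_of_upperDivisibility_of_transfer_of_thm331Mult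
    (hH : hsieh2014_exists_anticyclotomicPAdicLFunction_unrPeriod)
    (hR : bertoliniDarmonPrasanna2013_centralValue_reciprocity)
    (h124 : BurungaleCastellaSkinner2025.thm124b_exists_isBDPLFunction_isTorsion_charIdeal_eq)
    (h422 : BurungaleCastellaSkinner2025.prop422_exists_isBDPLFunction_mu_eq_zero)
    (h331 : thm331_anticyclotomicControl_mult)
    (hGZ : ∀ (N : ℕ) [NeZero N] (W : WeierstrassCurve ℚ) (K : Type) [Field K] [NumberField K],
      gross_zagier N W K)
    (hKo : ∀ (N : ℕ) [NeZero N] (W : WeierstrassCurve ℚ) (K : Type) [Field K] [NumberField K],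
      kolyvagin N W K)
    (hSk : Skinner2016.thmC_padicValRat_bsd_rank_zero) (hWu : sha_dvd_analyticSha)
    (hGZK : rank_eq_analyticRank_of_analyticRank_le_one) (hmod : hasEntireLFunction_rat)
    (hnf : exists_isNewformOf) (hMaz : mazur_not_dvd_maninConstant_of_odd)
    (hHL : HoffsteinLuo1997_exists_twist_L_one_ne_zero)
    (hPT : ∀ (K : Type) [Field K] [NumberField K], poitouTate_sum_localTatePairing_eq_zero K)
    (hEP : ∀ (K : Type) [Field K] [NumberField K] (v : HeightOneSpectrum (𝓞 K)),
      localEulerPoincareCharacteristic (v.adicCompletion K))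
    (hB : thm210_thm211_bdpDisplay_pNew)
    (hUB : ∀ (W : WeierstrassCurve ℚ) [W.IsElliptic] [W.IsGloballyMinimal] (p : ℕ) [Fact p.Prime],
      Ram W p → (∀ P : (W.baseChange ℚ_[p]).toAffine.Point, p • P = 0 → P = 0) →
      ¬ (∃ (q : ℕ) (_ : Fact q.Prime), q ≠ 2 ∧ q ≠ p ∧ Mult W q ∧
          ¬ W.HasSplitMultiplicativeReductionAtPrime q ∧ ¬ p ∣ padicValInt q W.minimalDiscriminantInt) →
      ∀ (N : ℕ) [NeZero N] (K : Type) [Field K] [NumberField K]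
        (Dt : ModularParametrizationData W N) (H : HeegnerDatum N (NumberField.discr K)) (ι : K →+* ℂ)
        (P : (W.baseChange K).toAffine.Point),
        ClassX11b W p → 5 ≤ p → Surj W p → W.conductorNorm ℤ = N → IsImaginaryQuadratic K →
        Odd (NumberField.discr K) → NumberField.discr K ≠ -3 → ¬ (p : ℤ) ∣ NumberField.discr K →
        ¬ p ∣ Units.torsionOrder K → SatisfiesHeegnerHypothesis N K →
        (W.quadraticTwist (NumberField.discr K : ℚ)).entireLFunction 1 ≠ 0 →
        WeierstrassCurve.Affine.Point.map ι.toRatAlgHom P = heegnerPointComplex Dt H →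
        ¬ (p : ℤ) ∣ Dt.c → ¬ IsOfFinAddOrder P →
        ∀ (κ : ZpExtension K p), κ.IsAnticyclotomic →
          ∀ (γ : Field.absoluteGaloisGroup K) [Fact (κ.IsTopGenerator γ)]
            (ι' : PadicAlgCl p ≃+* ℂ) (w₀ : InfinitePlace K) (P' : (W.baseChange K).toAffine.Point),
            WeierstrassCurve.Affine.Point.map w₀.embedding.toRatAlgHom P' = heegnerPointComplex Dt H →
            ∀ (e : K →+* ℚ_[p]),
              (∀ k : 𝓞 K, k ∈ (primeOfEmbeddingDatum p ι' w₀.embedding).asIdeal ↔ ‖e (k : K)‖ < 1) →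
              ∀ (ΩK : ℂ) (Ωp : (unrIntegers p)ˣ) (L : UnrSeries p), ΩK ≠ 0 →
                IsBDPLFunction ι' (primeOfEmbeddingDatum p ι' w₀.embedding) κ γ Dt.f ΩK
                  ((Ωp : unrIntegers p) : ℂ_[p]) L →
                ∀ (𝔭bar : HeightOneSpectrum (𝓞 K)), ((p : ℕ) : 𝓞 K) ∈ 𝔭bar.asIdeal →
                  𝔭bar ≠ primeOfEmbeddingDatum p ι' w₀.embedding →
                  L ∈ (XAc.charIdeal (W.baseChange K) p κ 𝔭bar ∅ γ).map (PowerSeries.map (toUnr p)))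
    (hTR : ∀ (W : WeierstrassCurve ℚ) [W.IsElliptic] [W.IsGloballyMinimal] (p : ℕ) [Fact p.Prime],
      Ram W p → (∀ P : (W.baseChange ℚ_[p]).toAffine.Point, p • P = 0 → P = 0) →
      ¬ (∃ (q : ℕ) (_ : Fact q.Prime), q ≠ 2 ∧ q ≠ p ∧ Mult W q ∧
          ¬ W.HasSplitMultiplicativeReductionAtPrime q ∧ ¬ p ∣ padicValInt q W.minimalDiscriminantInt) →
      ∀ (N : ℕ) [NeZero N] (K : Type) [Field K] [NumberField K]
        (Dt : ModularParametrizationData W N) (H : HeegnerDatum N (NumberField.discr K)) (ι : K →+* ℂ)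
        (P : (W.baseChange K).toAffine.Point),
        ClassX11b W p → 5 ≤ p → Surj W p → W.conductorNorm ℤ = N → IsImaginaryQuadratic K →
        Odd (NumberField.discr K) → NumberField.discr K ≠ -3 → ¬ (p : ℤ) ∣ NumberField.discr K →
        ¬ p ∣ Units.torsionOrder K → SatisfiesHeegnerHypothesis N K →
        (W.quadraticTwist (NumberField.discr K : ℚ)).entireLFunction 1 ≠ 0 →
        WeierstrassCurve.Affine.Point.map ι.toRatAlgHom P = heegnerPointComplex Dt H →
        ¬ (p : ℤ) ∣ Dt.c → ¬ IsOfFinAddOrder P →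
        ∀ (κ : ZpExtension K p), κ.IsAnticyclotomic →
          ∀ (γ : Field.absoluteGaloisGroup K) [Fact (κ.IsTopGenerator γ)]
            (ι' : PadicAlgCl p ≃+* ℂ) (w₀ : InfinitePlace K) (P' : (W.baseChange K).toAffine.Point),
            WeierstrassCurve.Affine.Point.map w₀.embedding.toRatAlgHom P' = heegnerPointComplex Dt H →
            ∀ (e : K →+* ℚ_[p]),
              (∀ k : 𝓞 K, k ∈ (primeOfEmbeddingDatum p ι' w₀.embedding).asIdeal ↔ ‖e (k : K)‖ < 1) →
              ∀ (ΩK : ℂ) (Ωp : (unrIntegers p)ˣ) (L : UnrSeries p), ΩK ≠ 0 →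
                IsBDPLFunction ι' (primeOfEmbeddingDatum p ι' w₀.embedding) κ γ Dt.f ΩK
                  ((Ωp : unrIntegers p) : ℂ_[p]) L →
                ∀ (𝔭bar : HeightOneSpectrum (𝓞 K)), ((p : ℕ) : 𝓞 K) ∈ 𝔭bar.asIdeal →
                  𝔭bar ≠ primeOfEmbeddingDatum p ι' w₀.embedding →
                  ∃ (W' : WeierstrassCurve ℚ) (_ : W'.IsElliptic) (_ : W'.IsGloballyMinimal) (N' : ℕ)
                    (_ : NeZero N') (Dt' : ModularParametrizationData W' N'),
                    GoodOrd W' p ∧ Surj W' p ∧ SatisfiesHeegnerHypothesis N' K ∧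
                    ∀ (g g' : IwasawaAlgebra p),
                      XAc.charIdeal (W.baseChange K) p κ 𝔭bar ∅ γ = Ideal.span {g} →
                      XAc.charIdeal (W'.baseChange K) p κ 𝔭bar ∅ γ = Ideal.span {g'} →
                      ∀ (ΩK' : ℂ) (Ωp' : (unrIntegers p)ˣ) (L' : UnrSeries p), ΩK' ≠ 0 →
                        IsBDPLFunction ι' (primeOfEmbeddingDatum p ι' w₀.embedding) κ γ Dt'.f ΩK'
                          ((Ωp' : unrIntegers p) : ℂ_[p]) L' →
                        ∃ (P P' u : UnrSeries p) (m m' : ℕ),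
                          (‖((coeff m P : unrIntegers p) : ℂ_[p])‖ = 1 ∧
                            ∀ i < m, ‖((coeff i P : unrIntegers p) : ℂ_[p])‖ < 1) ∧
                          (‖((coeff m' P' : unrIntegers p) : ℂ_[p])‖ = 1 ∧
                            ∀ i < m', ‖((coeff i P' : unrIntegers p) : ℂ_[p])‖ < 1) ∧
                          IsUnit u ∧
                          (∀ i, ‖((coeff i (u * (L' * P')) : unrIntegers p) : ℂ_[p]) -
                            ((coeff i (L * P) : unrIntegers p) : ℂ_[p])‖ < 1) ∧
                          ((∃ a, (‖((coeff a (PowerSeries.map (toUnr p) g * P) : unrIntegers p) : ℂ_[p])‖ = 1 ∧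
                              ∀ i < a, ‖((coeff i (PowerSeries.map (toUnr p) g * P) : unrIntegers p) :
                                ℂ_[p])‖ < 1)) →
                            ∃ a', (‖((coeff a' (PowerSeries.map (toUnr p) g' * P') : unrIntegers p) :
                              ℂ_[p])‖ = 1 ∧
                              ∀ i < a', ‖((coeff i (PowerSeries.map (toUnr p) g' * P') : unrIntegers p) :
                                ℂ_[p])‖ < 1)) ∧
                          (∀ a a', (‖((coeff a (PowerSeries.map (toUnr p) g * P) : unrIntegers p) : ℂ_[p])‖ = 1 ∧
                              ∀ i < a, ‖((coeff i (PowerSeries.map (toUnr p) g * P) : unrIntegers p) :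
                                ℂ_[p])‖ < 1) →
                            (‖((coeff a' (PowerSeries.map (toUnr p) g' * P') : unrIntegers p) : ℂ_[p])‖ = 1 ∧
                              ∀ i < a', ‖((coeff i (PowerSeries.map (toUnr p) g' * P') : unrIntegers p) :
                                ℂ_[p])‖ < 1) → a = a')) :
    Rest3NoWitnessBranchAtFive :=
  rest3NoWitnessBranchAtFive_of_imcDivSomeFrameB_guarded_of_pNew_of_thm331Mult h331 hGZ hKo hSk hWu hGZK hmod hnf
    hMaz hHL hPT hEP hB
    (fun W _ _ p _ hram htors hno ↦
      P2.imcDivSomeFrameB_guarded_of_thm124b_of_unrFrame_of_upperDivisibility_of_transfer h124 h422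
        (P2.unrFrame_of_hsieh2014_unrPeriod_of_bdp2013 hH hR) (hUB W p hram htors hno) (hTR W p hram htors hno))

end Summit.BirchSwinnertonDyer.BirchSwinnertonDyer.Theorems.Rest3GuardedB12

end
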